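import Summits.CriticalPhenomena.SAWScalingLimit.Theorems.SAWCircleScreeningScreeningRecursionStep
import Summits.CriticalPhenomena.SAWScalingLimit.Theorems.SAWCircleScreeningScreeningRecursionGeomD
import Summits.CriticalPhenomena.SAWScalingLimit.Theorems.SAWCircleScreeningScreeningRecursionCurve
import Summits.CriticalPhenomena.SAWScalingLimit.Theorems.SAWCircleScreeningEndpointCouplingTameReduction
import Summits.CriticalPhenomena.SAWScalingLimit.Theorems.SAWCircleScreeningEndpointCouplingTame
import HarnessLib

/-!
# Screening recursion for `SAWCircleScreening`: the support item `ScreeningRecursion`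

Route `SAWCircleScreening` of `CriticalPhenomena/SAWScalingLimit`, support item
`ScreeningRecursion` (stmt-CriticalPhenomena-5468):

  `ScreenOverlap → NoDeepReturn → EndpointCouplingTame`.

**Proof.** By the tree's reduction `endpointCouplingTame_of_oneEndpoint` it suffices to couple,
in a Dobrushin domain `D` flat (an open half-disc of radius `ρ₀`) at `c = D.pt 0`, the critical
SAWs from two approximations `a_δ`, `a'_δ → c` to a common target `b_δ → D.pt 1`. Fix `ε > 0`.
With `c₁` the overlap constant of `ScreenOverlap` (S2), put `η = min (c₁/8) (ε c₁/64)`,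
`θ = 1 - c₁ + 4η < 1`, take `M ≥ 4` from `NoDeepReturn` (S3) at level `η`, `m` with
`θ^m < ε/8`, and a top scale `ρ_m` below `ρ₀ /(M+1)`, the junk-component threshold of
`exists_params_meshDomain_diff` (part VI), `dist(c, D.pt 1)/4` and `ε/16`; scales
`s_k = ρ_m/(M+1)^k`, `k ≤ m`. Let `Φ` forget the initial segment of a walk before its first
exit from `B(c, ρ_m)`. By downward induction on the scale, using the one-scale coupling step
`one_step` (part XVI) fed by (S2), (S3) at scale `s_{k+1}` (flatness of `D` in the smaller
balls, `flat_inter_ball_of_le`), any two class-`s_k` configurations have `Φ`-laws within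
`θ^k + 4η/(1-θ)` on every set; at `k = m` this applies to `(∅, a_δ)`, `(∅, a'_δ)` for all
small `δ` (`IsEndpointApprox`). Walks with the same `Φ` have curves within `2(ρ_m + δ)`
(`dist_curve_le_of_common_suffix`, part V), so `d_LP ≤ max (2(ρ_m+δ)) (θ^m + 4η/(1-θ)) < ε`
(`levyProkhorovEDist_map_le_of_tail`). Transposition to `ℤ²` SAW of Garban–Pete–Schramm,
*Pivotal, cluster and interface measures for critical planar percolation*, JAMS 26 (2013), §3
(proof of Prop. 11), with Lawler–Schramm–Werner, *On the scaling limit of planar self-avoiding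
walk* (2004), §3 (Markov property and reversibility of `μ^{-|ω|}`).
-/

noncomputable section

open Set Metric MeasureTheory Filter Topology
open scoped ENNReal
open Literature.Probability.LatticeModels
open Literature.Probability.RandomPlanarGeometry
open Literature.Probability.RandomPlanarGeometry.SAW

namespace Summit.CriticalPhenomena.SAWScalingLimit.Theorems.ScreeningRecursion

open Summit.CriticalPhenomena.SAWScalingLimit.Theses.SAWCircleScreening

/-- Forgetting the initial segment inside `B(c, R⋆)` is invariant under prepending vertices
inside `B(c, R⋆)`. [folklore] -/
theorem drop_findIdx_append {δ : ℝ} {c : ℂ} {Rstar : ℝ} (pfx l : List (Site 2))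
    (hpfx : ∀ w ∈ pfx, dist (meshPoint δ w) c < Rstar) :
    (pfx ++ l).drop ((pfx ++ l).findIdx fun w => decide (Rstar ≤ dist (meshPoint δ w) c)) =
      l.drop (l.findIdx fun w => decide (Rstar ≤ dist (meshPoint δ w) c)) := by
  induction pfx with
  | nil => rfl
  | cons w pfx ih =>
    have hw : decide (Rstar ≤ dist (meshPoint δ w) c) = false :=
      decide_eq_false (not_le.2 (hpfx w (List.mem_cons_self)))
    rw [List.cons_append, List.findIdx_cons, hw]
    simpa using ih (fun w' hw' => hpfx w' (List.mem_cons_of_mem _ hw'))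

/-- A vertex joined to a different vertex in `Ω_δ` lies in `Ω_δ`. [folklore] -/
theorem mem_meshDomain_of_reachable_ne {Ω : Set ℂ} {δ : ℝ} {x y : Site 2}
    (h : (discreteDomainGraph Ω δ).Reachable x y) (hne : x ≠ y) : y ∈ meshDomain Ω δ := by
  obtain ⟨q⟩ := h
  have hadj := q.reverse.adj_snd (SimpleGraph.Walk.not_nil_of_ne hne.symm)
  exact (discreteDomainGraph_adj_iff.1 hadj).2.1

/-- **Walks with the same tail have close curves.** Two SAWs to a common far target `b` whose
supports agree from their first exits of `B(c, R)` on have curves within `2(R + δ)` (starts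
inside `B(c, R)`). [folklore] -/
theorem dist_curve_le_of_drop_eq {Ω : Set ℂ} {δ : ℝ} {c : ℂ} {R : ℝ} {x₁ x₂ b : Site 2}
    (hδ : 0 ≤ δ) (hR : 0 ≤ R) (hx₁ : dist (meshPoint δ x₁) c < R) (hx₂ : dist (meshPoint δ x₂) c < R)
    (hb : R ≤ dist (meshPoint δ b) c) (γ₁ : DomainSAW Ω δ x₁ b) (γ₂ : DomainSAW Ω δ x₂ b)
    (h : γ₁.walk.support.drop (γ₁.walk.support.findIdx fun w => decide (R ≤ dist (meshPoint δ w) c)) =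
      γ₂.walk.support.drop (γ₂.walk.support.findIdx fun w => decide (R ≤ dist (meshPoint δ w) c))) :
    dist γ₁.curve γ₂.curve ≤ 2 * (R + δ) := by
  obtain ⟨hpos₁, ⟨hn₁, -⟩, hin₁⟩ := firstExit_spec (r := R) (c := c) γ₁.walk.support
    (SimpleGraph.Walk.support_ne_nil _) (by rw [SimpleGraph.Walk.head_support]; exact hx₁)
    (by rw [SimpleGraph.Walk.getLast_support]; exact hb)
  obtain ⟨-, ⟨hn₂, -⟩, hin₂⟩ := firstExit_spec (r := R) (c := c) γ₂.walk.support
    (SimpleGraph.Walk.support_ne_nil _) (by rw [SimpleGraph.Walk.head_support]; exact hx₂)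
    (by rw [SimpleGraph.Walk.getLast_support]; exact hb)
  generalize hn₁eq : (γ₁.walk.support.findIdx fun w => decide (R ≤ dist (meshPoint δ w) c)) = n₁
    at hpos₁ hn₁ hin₁ h
  generalize hn₂eq : (γ₂.walk.support.findIdx fun w => decide (R ≤ dist (meshPoint δ w) c)) = n₂
    at hn₂ hin₂ h
  have h₁ : γ₁.walk.support = γ₁.walk.support.take n₁ ++ γ₁.walk.support.drop n₁ :=
    (List.take_append_drop _ _).symm
  have h₂ : γ₂.walk.support = γ₂.walk.support.take n₂ ++ γ₁.walk.support.drop n₁ := by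
    rw [h]; exact (List.take_append_drop _ _).symm
  have hne : γ₁.walk.support.drop n₁ ≠ [] := by
    rw [ne_eq, List.drop_eq_nil_iff]; omega
  have hlen : γ₁.walk.support.length = γ₁.walk.length + 1 := SimpleGraph.Walk.length_support _
  have hn₁' : n₁ - 1 < γ₁.walk.support.length := by omega
  have hadj := γ₁.walk.adj_getVert_succ (i := n₁ - 1) (by omega)
  rw [show n₁ - 1 + 1 = n₁ by omega, getVert_eq_getElem_support _ hn₁',
    getVert_eq_getElem_support _ hn₁] at hadj
  obtain ⟨hm, -, -⟩ := discreteDomainGraph_adj_iff.1 hadj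
  have hd := dist_meshPoint_le_of_adj hδ (meshGraph_adj_iff.1 hm).1
  have hprev : dist (meshPoint δ (γ₁.walk.support[n₁ - 1]'hn₁')) c < R := by
    have hmem : (γ₁.walk.support.take n₁)[n₁ - 1]'(by rw [List.length_take]; omega) ∈
        γ₁.walk.support.take n₁ := List.getElem_mem _
    rw [List.getElem_take] at hmem
    exact hin₁ _ hmem
  refine dist_curve_le_of_common_suffix γ₁ γ₂ _ _ _ h₁ h₂ hne (z₀ := c) (by linarith) ?_ ?_ ?_
  · rw [List.head_drop, mem_closedBall]
    have htri := dist_triangle (meshPoint δ (γ₁.walk.support[n₁]'hn₁))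
      (meshPoint δ (γ₁.walk.support[n₁ - 1]'hn₁')) c
    rw [dist_comm] at hd
    linarith
  · intro w hw; exact mem_closedBall.2 (by linarith [hin₁ w hw])
  · intro w hw; exact mem_closedBall.2 (by linarith [hin₂ w hw])

/-- **One-endpoint coupling from the two cruxes.** In a Dobrushin domain flat near `D.pt 0`,
the critical SAW laws from two approximations of `D.pt 0` to a common approximation of `D.pt 1`
are asymptotically equal in Lévy–Prokhorov distance. [folklore; Garban–Pete–Schramm 2013 §3
transposed] -/
theorem oneEndpoint_coupling (h₂ : ScreenOverlap) (h₃ : NoDeepReturn) (D : DobrushinDomain)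
    (a a' b : ℝ → Site 2)
    (hfl : ∃ (ρ₀ : ℝ) (u₀ : ℂ), 0 < ρ₀ ∧ D.carrier ∩ Metric.ball (D.pt 0) ρ₀ =
      {z | u₀ = 0 ∨ 0 < ((z - D.pt 0) * u₀).im} ∩ Metric.ball (D.pt 0) ρ₀)
    (hab : IsEndpointApprox D a b) (ha'b : IsEndpointApprox D a' b) :
    Tendsto (fun δ ↦ levyProkhorovDist
      ((law D.carrier δ (a δ) (b δ)).map fun γ ↦ γ.curve)
      ((law D.carrier δ (a' δ) (b δ)).map fun γ ↦ γ.curve)) (𝓝[>] (0 : ℝ)) (𝓝 0) := by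
  classical
  obtain ⟨ρ₀, u₀, hρ₀, hflat0⟩ := hfl
  set c : ℂ := D.pt 0 with hc
  have hu : u₀ ≠ 0 := normal_ne_zero_of_flat D 0 hρ₀ hflat0
  have hflat : D.carrier ∩ ball c ρ₀ = {z | 0 < ((z - c) * u₀).im} ∩ ball c ρ₀ := by
    rw [hflat0]; ext z; simp [hu]
  have hΩb : Bornology.IsBounded D.carrier := D.isBounded
  obtain ⟨c₁₀, hc₁₀, hS2⟩ := h₂
  -- WLOG the overlap constant is `≤ 1`
  set c₁ : ℝ := min c₁₀ 1 with hc₁def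
  have hc₁ : 0 < c₁ := lt_min hc₁₀ one_pos
  have hc₁1 : c₁ ≤ 1 := min_le_right _ _
  have hc₁le : ENNReal.ofReal c₁ ≤ ENNReal.ofReal c₁₀ := ENNReal.ofReal_le_ofReal (min_le_left _ _)
  rw [Metric.tendsto_nhds]
  intro ε hε
  -- constants
  set η : ℝ := min (c₁ / 8) (ε * c₁ / 64) with hηdef
  have hη : 0 < η := lt_min (by positivity) (by positivity)
  have hη1 : η ≤ c₁ / 8 := min_le_left _ _
  have hη2 : η ≤ ε * c₁ / 64 := min_le_right _ _
  set θ : ℝ := 1 - c₁ + 4 * η with hθdef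
  have hθ0 : 0 ≤ θ := by rw [hθdef]; linarith
  have hθ1 : θ < 1 := by rw [hθdef]; linarith
  have h1θ : c₁ / 2 ≤ 1 - θ := by rw [hθdef]; linarith
  set E : ℝ := 4 * η / (1 - θ) with hEdef
  have hE0 : 0 ≤ E := div_nonneg (by positivity) (by linarith)
  have hEε : E ≤ ε / 8 := by
    rw [hEdef, div_le_iff₀ (by linarith)]
    calc 4 * η ≤ ε * c₁ / 16 := by linarith
      _ = ε / 8 * (c₁ / 2) := by ring
      _ ≤ ε / 8 * (1 - θ) := mul_le_mul_of_nonneg_left h1θ (by positivity)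
  obtain ⟨M, hM4, hS3⟩ := h₃ η hη
  have hM1 : 1 ≤ M + 1 := by linarith
  have hMne : M + 1 ≠ 0 := ne_of_gt (by linarith)
  obtain ⟨m, hm⟩ := exists_pow_lt_of_lt_one (show 0 < ε / 8 by positivity) hθ1
  obtain ⟨ρmax, hρmax, δ₀, hδ₀, hgeomD⟩ := exists_params_meshDomain_diff D.toJordanDomain hρ₀ hu hflat
  set L : ℝ := dist (D.pt 1) c with hLdef
  have hL : 0 < L := dist_pos.2 (D.pt_injective.ne (by decide))
  set ρm : ℝ := min (min (ρ₀ / (M + 1)) ρmax) (min (L / 4) (ε / 16)) with hρmdef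
  have hρm : 0 < ρm := lt_min (lt_min (by positivity) hρmax) (lt_min (by positivity) (by positivity))
  have hρmρ₀ : (M + 1) * ρm ≤ ρ₀ := by
    have : ρm ≤ ρ₀ / (M + 1) := (min_le_left _ _).trans (min_le_left _ _)
    rwa [le_div_iff₀ (by linarith), mul_comm] at this
  have hρmρ₀' : ρm ≤ ρ₀ := by nlinarith
  have hρmmax : ρm ≤ ρmax := (min_le_left _ _).trans (min_le_right _ _)
  have hρmL : ρm ≤ L / 4 := (min_le_right _ _).trans (min_le_left _ _)
  have hρmε : ρm ≤ ε / 16 := (min_le_right _ _).trans (min_le_right _ _)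
  -- scales `s k = ρm / (M+1)^k`
  set s : ℕ → ℝ := fun k => ρm / (M + 1) ^ k with hsdef
  have hspos : ∀ k, 0 < s k := fun k => div_pos hρm (pow_pos (by linarith) k)
  have hsucc : ∀ k, (M + 1) * s (k + 1) = s k := fun k => by
    show (M + 1) * (ρm / (M + 1) ^ (k + 1)) = ρm / (M + 1) ^ k
    rw [pow_succ]
    field_simp
  have hsle : ∀ k, s k ≤ ρm := fun k => div_le_self hρm.le (one_le_pow₀ hM1)
  have hsanti : ∀ k k', k ≤ k' → s k' ≤ s k := fun k k' hkk' =>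
    div_le_div_of_nonneg_left hρm.le (by positivity) (pow_le_pow_right₀ hM1 hkk')
  set ρ0 : ℝ := s m with hρ0def
  have hρ0 : 0 < ρ0 := hspos m
  -- eventually in `δ`
  have ev1 : ∀ᶠ δ in 𝓝[>] (0 : ℝ), 0 < δ := eventually_mem_nhdsWithin
  have ev2 : ∀ᶠ δ in 𝓝[>] (0 : ℝ), δ < min δ₀ (ρ0 / 2) :=
    (eventually_lt_nhds (lt_min hδ₀ (half_pos hρ0))).filter_mono nhdsWithin_le_nhds
  have ev3 := hab.reachable
  have ev4 := ha'b.reachable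
  have ev5 : ∀ᶠ δ in 𝓝[>] (0 : ℝ), dist (meshPoint δ (a δ)) c < ρ0 :=
    Metric.tendsto_nhds.1 hab.tendsto_fst ρ0 hρ0
  have ev6 : ∀ᶠ δ in 𝓝[>] (0 : ℝ), dist (meshPoint δ (a' δ)) c < ρ0 :=
    Metric.tendsto_nhds.1 ha'b.tendsto_fst ρ0 hρ0
  have ev7 : ∀ᶠ δ in 𝓝[>] (0 : ℝ), dist (meshPoint δ (b δ)) (D.pt 1) < L / 2 :=
    Metric.tendsto_nhds.1 hab.tendsto_snd (L / 2) (by positivity)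
  filter_upwards [ev1, ev2, ev3, ev4, ev5, ev6, ev7] with δ hδ hδ2 hr hr' haδ ha'δ hbδ
  have hδδ₀ : δ ≤ δ₀ := (hδ2.le.trans (min_le_left _ _))
  have hδρ0 : 2 * δ ≤ ρ0 := by have := hδ2.le.trans (min_le_right _ _); linarith
  have hbL : L / 2 < dist (meshPoint δ (b δ)) c := by
    have := dist_triangle_left (D.pt 1) c (meshPoint δ (b δ))
    linarith [hLdef]
  set bδ := b δ with hbδdef
  -- `b_δ` is a vertex of `Ω_δ`, also after removing near data up to radius `ρm`
  have hρ0m : ρ0 ≤ ρm := hsle m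
  have hab_ne : a δ ≠ bδ := by
    intro h; rw [h] at haδ; linarith
  have hbmem : bδ ∈ meshDomain D.carrier δ := mem_meshDomain_of_reachable_ne hr hab_ne
  have hgeom : ∀ K' : Set ℂ, K' ⊆ closedBall c ρm → bδ ∈ meshDomain (D.carrier \ K') δ :=
    fun K' hK' => hgeomD ρm δ ρm hρm hρmmax hδ hδδ₀ (by linarith) hρm.le (by linarith)
      K' hK' bδ hbmem (by linarith)
  -- the observable
  set Φ : List (Site 2) → List (Site 2) := fun l =>
    l.drop (l.findIdx fun w => decide (ρm ≤ dist (meshPoint δ w) c)) with hΦdef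
  have hΦ : ∀ pfx l : List (Site 2), (∀ w ∈ pfx, dist (meshPoint δ w) c < ρm) →
      (∃ h : l ≠ [], dist (meshPoint δ (l.head h)) c < ρm) → Φ (pfx ++ l) = Φ l :=
    fun pfx l hpfx _ => drop_findIdx_append pfx l hpfx
  -- the multi-scale induction
  have key : ∀ k ≤ m, ∀ (K K' : Set ℂ) (x x' : Site 2), K ⊆ closedBall c (s k) →
      K' ⊆ closedBall c (s k) → dist (meshPoint δ x) c ≤ s k → dist (meshPoint δ x') c ≤ s k →
      (discreteDomainGraph (D.carrier \ K) δ).Reachable x bδ →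
      (discreteDomainGraph (D.carrier \ K') δ).Reachable x' bδ →
      ∀ A : Set (List (Site 2)), (law (D.carrier \ K) δ x bδ {γ | Φ γ.walk.support ∈ A}).toReal ≤
        (law (D.carrier \ K') δ x' bδ {γ | Φ γ.walk.support ∈ A}).toReal + (θ ^ k + E) := by
    intro k
    induction k with
    | zero =>
      intro _ K K' x x' _ _ _ _ _ _ A
      have h1 : (law (D.carrier \ K) δ x bδ {γ | Φ γ.walk.support ∈ A}).toReal ≤ 1 := by
        have := ENNReal.toReal_mono ENNReal.one_ne_top
          (law_apply_le_one (Ω := D.carrier \ K) (δ := δ) (a := x) (b := bδ) {γ | Φ γ.walk.support ∈ A})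
        simpa using this
      have h2 : 0 ≤ (law (D.carrier \ K') δ x' bδ {γ | Φ γ.walk.support ∈ A}).toReal :=
        ENNReal.toReal_nonneg
      rw [pow_zero]; linarith
    | succ k ih =>
      intro hk K K' x x' hK hK' hx hx' hxr hxr' A
      have ih' := ih (by omega)
      -- the scale `ρ = s (k+1)`, `(M+1) ρ = s k`
      have hρlo : ρ0 ≤ s (k + 1) := hsanti _ _ hk
      have hρhi : (M + 1) * s (k + 1) ≤ ρm := (hsucc k).le.trans (hsle k)
      have hρ : 0 < s (k + 1) := hspos _
      have hδρ : 2 * δ ≤ s (k + 1) := hδρ0.trans hρlo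
      have hMρ : M * s (k + 1) ≤ ρm - s (k + 1) := by linarith
      have h4ρ : 4 * s (k + 1) ≤ M * s (k + 1) := by nlinarith
      have hbfar : M * s (k + 1) + δ ≤ dist (meshPoint δ bδ) c := by linarith
      have hstep := one_step (Ω₀ := D.carrier) (c := c) (u := u₀) (ρ₀ := ρ₀) (ρ := s (k + 1)) (M := M)
        (Rstar := ρm) (η := η) (d := θ ^ k + E) (c₁ := c₁) (b := bδ) hΩb hflat hδ hδρ hM4
        (by linarith) hbfar
        (fun K'' hK'' => hgeom K'' (hK''.trans (closedBall_subset_closedBall (by linarith))))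
        Φ (by linarith) hΦ hη.le (add_nonneg (pow_nonneg hθ0 _) hE0) ?_ ?_ ?_ K K' x x' hK hK' hx hx'
        hxr hxr' A
      · have h1θne : (1 - θ) ≠ 0 := ne_of_gt (by linarith)
        have e : 4 * η + θ * (θ ^ k + E) = θ ^ (k + 1) + E := by
          rw [hEdef, pow_succ]
          field_simp
          ring
        rw [← hθdef] at hstep
        linarith
      · -- (S2) at scale `s (k+1)`
        intro K₁ K₂ x₁ x₂ hK₁ hK₂ hx₁ hx₂ hr₁ hr₂
        refine hc₁le.trans (hS2 D.toJordanDomain K₁ K₂ c u₀ δ (s (k + 1)) x₁ x₂ bδ hδ hδρ hK₁ hK₂ ?_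
          hx₁ hx₂ (by linarith) hr₁ hr₂)
        exact flat_inter_ball_of_le hflat0 (by linarith)
      · -- (S3) at scale `s (k+1)`
        intro K₁ x₁ hK₁ hx₁ hr₁
        exact hS3 D.toJordanDomain K₁ c u₀ δ (s (k + 1)) x₁ bδ hδ hδρ hK₁
          (flat_inter_ball_of_le hflat0 (by linarith)) hx₁ (by linarith) hr₁
      · -- induction hypothesis at scale `s k = (M+1) s (k+1)`
        intro K₁ K₂ x₁ x₂ hK₁ hK₂ hx₁ hx₂ hr₁ hr₂ A'
        rw [hsucc k] at hK₁ hK₂ hx₁ hx₂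
        exact ih' K₁ K₂ x₁ x₂ hK₁ hK₂ hx₁ hx₂ hr₁ hr₂ A'
  -- apply at the bottom scale to `(∅, a_δ)`, `(∅, a'_δ)`
  have hbase := key m le_rfl ∅ ∅
  simp only [Set.empty_subset, forall_const] at hbase
  rw [Set.sdiff_empty] at hbase
  have h12 := hbase (a δ) (a' δ) haδ.le ha'δ.le hr hr'
  have h21 := hbase (a' δ) (a δ) ha'δ.le haδ.le hr' hr
  have hbnd : θ ^ m + E < ε / 4 := by linarith
  -- Lévy–Prokhorov via the tail observable
  set P := law D.carrier δ (a δ) bδ with hP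
  set P' := law D.carrier δ (a' δ) bδ with hP'
  have hbfar' : ρm ≤ dist (meshPoint δ bδ) c := by linarith
  have haρm : dist (meshPoint δ (a δ)) c < ρm := by linarith
  have ha'ρm : dist (meshPoint δ (a' δ)) c < ρm := by linarith
  have hLP : levyProkhorovEDist (P.map fun γ => γ.curve) (P'.map fun γ => γ.curve) ≤
      max (ENNReal.ofReal (2 * (ρm + δ))) (ENNReal.ofReal (θ ^ m + E)) := by
    refine levyProkhorovEDist_map_le_of_tail P P' (DomainSAW.measurable_of_top _)
      (DomainSAW.measurable_of_top _) (fun γ => Φ γ.walk.support) (fun γ => Φ γ.walk.support)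
      (fun γ₁ γ₂ hΦeq => ?_) (fun A => ?_) (fun A => ?_)
    · rw [edist_dist]
      exact ENNReal.ofReal_le_ofReal (dist_curve_le_of_drop_eq hδ.le hρm.le haρm ha'ρm hbfar' γ₁ γ₂ hΦeq)
    · calc P ((fun γ => Φ γ.walk.support) ⁻¹' A)
          = ENNReal.ofReal (P ((fun γ => Φ γ.walk.support) ⁻¹' A)).toReal :=
            (ENNReal.ofReal_toReal (law_apply_ne_top _)).symm
        _ ≤ ENNReal.ofReal ((P' ((fun γ => Φ γ.walk.support) ⁻¹' A)).toReal + (θ ^ m + E)) :=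
            ENNReal.ofReal_le_ofReal (h12 A)
        _ ≤ ENNReal.ofReal (P' ((fun γ => Φ γ.walk.support) ⁻¹' A)).toReal + ENNReal.ofReal (θ ^ m + E) :=
            ENNReal.ofReal_add_le
        _ = _ := by rw [ENNReal.ofReal_toReal (law_apply_ne_top _)]
    · calc P' ((fun γ => Φ γ.walk.support) ⁻¹' A)
          = ENNReal.ofReal (P' ((fun γ => Φ γ.walk.support) ⁻¹' A)).toReal :=
            (ENNReal.ofReal_toReal (law_apply_ne_top _)).symm
        _ ≤ ENNReal.ofReal ((P ((fun γ => Φ γ.walk.support) ⁻¹' A)).toReal + (θ ^ m + E)) :=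
            ENNReal.ofReal_le_ofReal (h21 A)
        _ ≤ ENNReal.ofReal (P ((fun γ => Φ γ.walk.support) ⁻¹' A)).toReal + ENNReal.ofReal (θ ^ m + E) :=
            ENNReal.ofReal_add_le
        _ = _ := by rw [ENNReal.ofReal_toReal (law_apply_ne_top _)]
  have hnn : 0 ≤ levyProkhorovDist (P.map fun γ => γ.curve) (P'.map fun γ => γ.curve) :=
    ENNReal.toReal_nonneg
  rw [Real.dist_0_eq_abs, abs_of_nonneg hnn]
  have hmax : max (ENNReal.ofReal (2 * (ρm + δ))) (ENNReal.ofReal (θ ^ m + E)) ≤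
      ENNReal.ofReal (ε / 2) :=
    max_le (ENNReal.ofReal_le_ofReal (by linarith)) (ENNReal.ofReal_le_ofReal (by linarith))
  calc levyProkhorovDist (P.map fun γ => γ.curve) (P'.map fun γ => γ.curve)
      ≤ ε / 2 := ENNReal.toReal_le_of_le_ofReal (by positivity) (hLP.trans hmax)
    _ < ε := by linarith

/-- **`ScreeningRecursion`** (stmt-CriticalPhenomena-5468): the two cruxes `ScreenOverlap` (S2)
and `NoDeepReturn` (S3) give the tame endpoint-coupling item. [folklore; Garban–Pete–Schramm 2013
§3 transposed to SAW] -/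
theorem screeningRecursion_proof :
    Summit.CriticalPhenomena.SAWScalingLimit.Theses.SAWCircleScreening.ScreeningRecursion := by
  intro h₂ h₃
  exact endpointCouplingTame_of_oneEndpoint (oneEndpoint_coupling h₂ h₃)

end Summit.CriticalPhenomena.SAWScalingLimit.Theorems.ScreeningRecursion

end
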